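import Literature.Probability.Percolation.GladkovZiminKernel
import HarnessLib

/-!
# The three-copy Harris–Kleitman-type kernel inequality (Gladkov–Zimin, Thm. 5.1, case `k = 3`)

Topic `Literature/Probability/Percolation` (companion of `GladkovZiminKernel.lean`, `GladkovZiminCopositive.lean`).
Gladkov–Zimin [GladkovZimin2024HK, §5, Thm. 5.1] announce the `k`-function generalisation of their two-copy kernel
inequality (Thm. 2.3): for a product measure `μ` on the cube, `k` random points and a kernel `g` of `k` arguments
satisfying a four-point-type condition in each pair of endpoints, `E_{μ^k} g ≤ / ≥ E_μ g(x,…,x)`.  The draft's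
display (12) is garbled; this file states and proves the case `k = 3` with the hypothesis in the form the
one-coordinate induction actually needs (two "endpoint" inequalities, integrated against nonnegative weights):

* `E3s s w B f g h = Σ_{S,T,U ∈ s} w_S w_T w_U · B (f S) (g T) (h U)` — the weighted triple sum;
* `TripleSuper ι B` — for all finite families of comparable pairs `lo S ≤ hi S` with weights `w ≥ 0`:
  `E(lo,lo,hi) + E(lo,hi,lo) + E(hi,lo,lo) ≤ 2·E(lo,lo,lo) + E(hi,hi,hi)` and
  `E(lo,hi,hi) + E(hi,lo,hi) + E(hi,hi,lo) ≤ E(lo,lo,lo) + 2·E(hi,hi,hi)`;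
* `tripleSuper_of_pointwise` — the pointwise sufficient condition: for `a ≤ a'`, `b ≤ b'`, `c ≤ c'`,
  `B a b c' + B a b' c + B a' b c ≤ 2 B a b c + B a' b' c'` and `B a b' c' + B a' b c' + B a' b' c ≤ B a b c + 2 B a' b' c'`
  (in mixed differences around `(a,b,c)`: `Δ₁₂+Δ₁₃+Δ₂₃+Δ₁₂₃ ≥ 0` and `Δ₁₂+Δ₁₃+Δ₂₃+2Δ₁₂₃ ≥ 0`);
* **`ED3_le_diag_of_tripleSuper`** — for `p ∈ [0,1]^ι`, `B` triple-supermodular in this sense and `π` monotone along `⊆`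
  into a preorder: `E_{μ×μ×μ} B(π S, π T, π U) ≤ E_μ B(π S, π S, π S)`;
* `kernel3_classMass_le` — the same over class masses `m_a`: `Σ_{a,b,c} B a b c · m_a m_b m_c ≤ Σ_a B a a a · m_a`.

Proof: induction on the coordinates; restricting to `x_e = 0/1` in each of the three copies splits the triple
expectation into eight sections `E_ε`, `ε ∈ {0,1}³`, with weights `q^{|ε|}(1−q)^{3−|ε|}`, and the diagonal side into
two; with the induction hypothesis on `E₀₀₀`, `E₁₁₁` the defect equals
`q(1−q)[(1−q)(2E₀₀₀+E₁₁₁−E₀₀₁−E₀₁₀−E₁₀₀) + q(E₀₀₀+2E₁₁₁−E₀₁₁−E₁₀₁−E₁₁₀)] + (1−q)(Y₀−E₀₀₀) + q(Y₁−E₁₁₁) ≥ 0`.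
Application (percolation certificate programme of `Summits/CriticalPhenomena/PercolationContinuityZ3`, crux
`NoHeavyLowerTail`): cubic "three-copy GZ rows" `Σ_a B_aaa m_a ≥ Σ_{abc} B_abc m_a m_b m_c` for connection laws.

## References
* N. Gladkov, A. Zimin, *On Harris–Kleitman type inequalities*, unpublished draft, September 2024, Thm. 2.3 and §5,
  Thm. 5.1 (statement of the `k`-function generalisation). [GladkovZimin2024HK]
-/

namespace Literature.Probability.Percolation

noncomputable section

namespace DecisionTree

open Finset

variable {ι : Type*} [DecidableEq ι]

/-! ### Weighted triple sums and the hypothesis -/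

/-- The weighted triple sum `Σ_{S,T,U ∈ s} w_S w_T w_U · B (f S) (g T) (h U)`. [cite: GladkovZimin2024HK, §5] -/
def E3s {α κ : Type*} (s : Finset α) (w : α → ℝ) (B : κ → κ → κ → ℝ) (f g h : α → κ) : ℝ :=
  ∑ S ∈ s, ∑ T ∈ s, ∑ U ∈ s, w S * w T * w U * B (f S) (g T) (h U)

/-- **Triple supermodularity (integrated endpoint form).**  For every finite family of comparable pairs
`lo S ≤ hi S` with weights `w ≥ 0`, the two endpoint inequalities of the three-copy induction hold.
[cite: GladkovZimin2024HK, §5, Thm. 5.1 (k = 3)] -/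
def TripleSuper (ι : Type*) {κ : Type*} [Preorder κ] (B : κ → κ → κ → ℝ) : Prop :=
  ∀ (s : Finset (Finset ι)) (w : Finset ι → ℝ) (lo hi : Finset ι → κ),
    (∀ S ∈ s, 0 ≤ w S) → (∀ S ∈ s, lo S ≤ hi S) →
      E3s s w B lo lo hi + E3s s w B lo hi lo + E3s s w B hi lo lo ≤
          2 * E3s s w B lo lo lo + E3s s w B hi hi hi ∧
        E3s s w B lo hi hi + E3s s w B hi lo hi + E3s s w B hi hi lo ≤
          E3s s w B lo lo lo + 2 * E3s s w B hi hi hi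

omit [DecidableEq ι] in
/-- The pointwise endpoint inequalities imply triple supermodularity (every summand is nonnegative).
[cite: GladkovZimin2024HK, §5, Thm. 5.1 (k = 3), pointwise form of the hypothesis] -/
theorem tripleSuper_of_pointwise {κ : Type*} [Preorder κ] (B : κ → κ → κ → ℝ)
    (h0 : ∀ ⦃a a' b b' c c' : κ⦄, a ≤ a' → b ≤ b' → c ≤ c' →
      B a b c' + B a b' c + B a' b c ≤ 2 * B a b c + B a' b' c')
    (h1 : ∀ ⦃a a' b b' c c' : κ⦄, a ≤ a' → b ≤ b' → c ≤ c' →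
      B a b' c' + B a' b c' + B a' b' c ≤ B a b c + 2 * B a' b' c') :
    TripleSuper ι B := by
  intro s w lo hi hw hle
  have key : ∀ (F G : Finset ι → Finset ι → Finset ι → ℝ),
      (∀ S ∈ s, ∀ T ∈ s, ∀ U ∈ s, F S T U ≤ G S T U) →
      ∑ S ∈ s, ∑ T ∈ s, ∑ U ∈ s, w S * w T * w U * F S T U ≤
        ∑ S ∈ s, ∑ T ∈ s, ∑ U ∈ s, w S * w T * w U * G S T U := by
    intro F G hFG
    refine Finset.sum_le_sum fun S hS => Finset.sum_le_sum fun T hT => Finset.sum_le_sum fun U hU => ?_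
    exact mul_le_mul_of_nonneg_left (hFG S hS T hT U hU)
      (mul_nonneg (mul_nonneg (hw S hS) (hw T hT)) (hw U hU))
  unfold E3s
  constructor
  · have h := key (fun S T U => B (lo S) (lo T) (hi U) + B (lo S) (hi T) (lo U) + B (hi S) (lo T) (lo U))
      (fun S T U => 2 * B (lo S) (lo T) (lo U) + B (hi S) (hi T) (hi U))
      (fun S hS T hT U hU => h0 (hle S hS) (hle T hT) (hle U hU))
    simp only [mul_add, Finset.sum_add_distrib] at h
    have e2 : ∑ S ∈ s, ∑ T ∈ s, ∑ U ∈ s, w S * w T * w U * (2 * B (lo S) (lo T) (lo U)) =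
        2 * ∑ S ∈ s, ∑ T ∈ s, ∑ U ∈ s, w S * w T * w U * B (lo S) (lo T) (lo U) := by
      rw [Finset.mul_sum]; refine Finset.sum_congr rfl fun S _ => ?_
      rw [Finset.mul_sum]; refine Finset.sum_congr rfl fun T _ => ?_
      rw [Finset.mul_sum]; refine Finset.sum_congr rfl fun U _ => ?_
      ring
    linarith [h, e2]
  · have h := key (fun S T U => B (lo S) (hi T) (hi U) + B (hi S) (lo T) (hi U) + B (hi S) (hi T) (lo U))
      (fun S T U => B (lo S) (lo T) (lo U) + 2 * B (hi S) (hi T) (hi U))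
      (fun S hS T hT U hU => h1 (hle S hS) (hle T hT) (hle U hU))
    simp only [mul_add, Finset.sum_add_distrib] at h
    have e2 : ∑ S ∈ s, ∑ T ∈ s, ∑ U ∈ s, w S * w T * w U * (2 * B (hi S) (hi T) (hi U)) =
        2 * ∑ S ∈ s, ∑ T ∈ s, ∑ U ∈ s, w S * w T * w U * B (hi S) (hi T) (hi U) := by
      rw [Finset.mul_sum]; refine Finset.sum_congr rfl fun S _ => ?_
      rw [Finset.mul_sum]; refine Finset.sum_congr rfl fun T _ => ?_
      rw [Finset.mul_sum]; refine Finset.sum_congr rfl fun U _ => ?_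
      ring
    linarith [h, e2]

/-! ### Nested expectations versus weighted triple sums -/

/-- The three-fold nested cube expectation is the weighted triple sum with the cube weights. [folklore] -/
theorem ED_ED_ED_eq_E3s (D : Finset ι) (p : ι → ℝ) {κ : Type*} (B : κ → κ → κ → ℝ)
    (f g h : Finset ι → κ) :
    ED D p (fun S => ED D p (fun T => ED D p (fun U => B (f S) (g T) (h U)))) =
      E3s D.powerset (wtW D p) B f g h := by
  unfold ED E3s
  refine Finset.sum_congr rfl fun S _ => ?_
  rw [Finset.mul_sum]
  refine Finset.sum_congr rfl fun T _ => ?_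
  rw [Finset.mul_sum, Finset.mul_sum]
  refine Finset.sum_congr rfl fun U _ => ?_
  ring

/-! ### The three-copy inequality -/

/-- **Three-copy kernel inequality** (Gladkov–Zimin Thm. 5.1, `k = 3`).  For `p ∈ [0,1]^ι`, a triple-supermodular
kernel `B` on a preorder and every labelling `π` monotone along `⊆`:
`E_{μ×μ×μ} B(π S, π T, π U) ≤ E_μ B(π S, π S, π S)`. [cite: GladkovZimin2024HK, §5, Thm. 5.1] -/
theorem ED3_le_diag_of_tripleSuper (D : Finset ι) {p : ι → ℝ} (hp0 : ∀ i, 0 ≤ p i) (hp1 : ∀ i, p i ≤ 1)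
    {κ : Type*} [Preorder κ] (B : κ → κ → κ → ℝ) (hB : TripleSuper ι B) :
    ∀ π : Finset ι → κ, (∀ ⦃x y : Finset ι⦄, x ⊆ y → π x ≤ π y) →
      ED D p (fun S => ED D p (fun T => ED D p (fun U => B (π S) (π T) (π U)))) ≤
        ED D p (fun S => B (π S) (π S) (π S)) := by
  induction D using Finset.induction_on with
  | empty =>
    intro π _
    simp only [ED_empty, le_refl]
  | @insert e D' he ih =>
    intro π hπ
    have hq0 : 0 ≤ p e := hp0 e
    have hq1 : 0 ≤ 1 - p e := sub_nonneg.2 (hp1 e)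
    -- monotonicity of the shifted labelling and comparability `π S ≤ π (insert e S)`
    have hπ1 : ∀ ⦃x y : Finset ι⦄, x ⊆ y → π (insert e x) ≤ π (insert e y) :=
      fun x y hxy => hπ (Finset.insert_subset_insert e hxy)
    have hle : ∀ S ∈ D'.powerset, π S ≤ π (insert e S) := fun S _ => hπ (Finset.subset_insert e S)
    -- the eight sections and the two diagonal sections
    set E000 := ED D' p (fun S => ED D' p (fun T => ED D' p (fun U => B (π S) (π T) (π U)))) with hE000
    set E001 := ED D' p (fun S => ED D' p (fun T => ED D' p (fun U => B (π S) (π T) (π (insert e U))))) with hE001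
    set E010 := ED D' p (fun S => ED D' p (fun T => ED D' p (fun U => B (π S) (π (insert e T)) (π U)))) with hE010
    set E011 := ED D' p (fun S => ED D' p (fun T => ED D' p (fun U => B (π S) (π (insert e T)) (π (insert e U))))) with hE011
    set E100 := ED D' p (fun S => ED D' p (fun T => ED D' p (fun U => B (π (insert e S)) (π T) (π U)))) with hE100
    set E101 := ED D' p (fun S => ED D' p (fun T => ED D' p (fun U => B (π (insert e S)) (π T) (π (insert e U))))) with hE101
    set E110 := ED D' p (fun S => ED D' p (fun T => ED D' p (fun U => B (π (insert e S)) (π (insert e T)) (π U)))) with hE110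
    set E111 := ED D' p (fun S => ED D' p (fun T => ED D' p (fun U => B (π (insert e S)) (π (insert e T)) (π (insert e U))))) with hE111
    set Y0 := ED D' p (fun S => B (π S) (π S) (π S)) with hY0
    set Y1 := ED D' p (fun S => B (π (insert e S)) (π (insert e S)) (π (insert e S))) with hY1
    -- expansion of the three-fold expectation over `insert e D'`
    have hL : ED (insert e D') p (fun S => ED (insert e D') p (fun T => ED (insert e D') p
        (fun U => B (π S) (π T) (π U)))) =
        (1 - p e) * ((1 - p e) * ((1 - p e) * E000 + p e * E001) + p e * ((1 - p e) * E010 + p e * E011)) +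
          p e * ((1 - p e) * ((1 - p e) * E100 + p e * E101) + p e * ((1 - p e) * E110 + p e * E111)) := by
      simp only [hE000, hE001, hE010, hE011, hE100, hE101, hE110, hE111, ED_insert p he, ED_add, ED_mul_left]
    have hR : ED (insert e D') p (fun S => B (π S) (π S) (π S)) = (1 - p e) * Y0 + p e * Y1 := by
      rw [ED_insert p he]
    -- the hypothesis on the sections
    have hK := hB D'.powerset (wtW D' p) π (fun S => π (insert e S))
      (fun S _ => wtW_nonneg D' hp0 hp1 S) hle
    simp only [← ED_ED_ED_eq_E3s] at hK
    obtain ⟨hK0, hK1⟩ := hK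
    -- induction hypotheses on the two pure sections
    have hI0 : E000 ≤ Y0 := ih π hπ
    have hI1 : E111 ≤ Y1 := ih (fun S => π (insert e S)) hπ1
    rw [hL, hR]
    have t1 : 0 ≤ p e * (1 - p e) * (1 - p e) * (2 * E000 + E111 - (E001 + E010 + E100)) :=
      mul_nonneg (mul_nonneg (mul_nonneg hq0 hq1) hq1) (by linarith)
    have t2 : 0 ≤ p e * (1 - p e) * p e * (E000 + 2 * E111 - (E011 + E101 + E110)) :=
      mul_nonneg (mul_nonneg (mul_nonneg hq0 hq1) hq0) (by linarith)
    have t3 : 0 ≤ (1 - p e) * (Y0 - E000) := mul_nonneg hq1 (by linarith)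
    have t4 : 0 ≤ p e * (Y1 - E111) := mul_nonneg hq0 (by linarith)
    nlinarith [t1, t2, t3, t4]

/-- **The three-copy inequality over class masses.**  With `m_a` the class masses of a monotone labelling
`π` and `B` triple-supermodular: `Σ_{a,b,c ∈ t} B a b c · m_a m_b m_c ≤ Σ_{a ∈ t} B a a a · m_a` for every
finite `t` containing all labels. [cite: GladkovZimin2024HK, §5, Thm. 5.1 (k = 3)] -/
theorem kernel3_classMass_le (D : Finset ι) {p : ι → ℝ} (hp0 : ∀ i, 0 ≤ p i) (hp1 : ∀ i, p i ≤ 1)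
    {κ : Type*} [Preorder κ] [DecidableEq κ] (π : Finset ι → κ)
    (hπ : ∀ ⦃x y : Finset ι⦄, x ⊆ y → π x ≤ π y) (t : Finset κ) (ht : ∀ S ∈ D.powerset, π S ∈ t)
    (B : κ → κ → κ → ℝ) (hB : TripleSuper ι B) :
    ∑ a ∈ t, ∑ b ∈ t, ∑ c ∈ t, B a b c * (classMass D p π a * classMass D p π b * classMass D p π c) ≤
      ∑ a ∈ t, B a a a * classMass D p π a := by
  have h := ED3_le_diag_of_tripleSuper D hp0 hp1 B hB π hπ
  unfold ED at h
  -- diagonal side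
  rw [sum_wtW_mul_comp_eq_sum_classMass D p π t ht (fun a => B a a a)] at h
  -- innermost sum
  have h3 : ∀ S T : Finset ι, ∑ U ∈ D.powerset, wtW D p U * B (π S) (π T) (π U) =
      ∑ c ∈ t, B (π S) (π T) c * classMass D p π c := fun S T =>
    sum_wtW_mul_comp_eq_sum_classMass D p π t ht (fun c => B (π S) (π T) c)
  simp only [h3] at h
  have h2 : ∀ S : Finset ι, ∑ T ∈ D.powerset, wtW D p T * ∑ c ∈ t, B (π S) (π T) c * classMass D p π c =
      ∑ b ∈ t, (∑ c ∈ t, B (π S) b c * classMass D p π c) * classMass D p π b := fun S =>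
    sum_wtW_mul_comp_eq_sum_classMass D p π t ht (fun b => ∑ c ∈ t, B (π S) b c * classMass D p π c)
  simp only [h2] at h
  rw [sum_wtW_mul_comp_eq_sum_classMass D p π t ht
    (fun a => ∑ b ∈ t, (∑ c ∈ t, B a b c * classMass D p π c) * classMass D p π b)] at h
  calc ∑ a ∈ t, ∑ b ∈ t, ∑ c ∈ t, B a b c * (classMass D p π a * classMass D p π b * classMass D p π c)
      = ∑ a ∈ t, (∑ b ∈ t, (∑ c ∈ t, B a b c * classMass D p π c) * classMass D p π b) *
          classMass D p π a := by
        refine Finset.sum_congr rfl fun a _ => ?_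
        rw [Finset.sum_mul]
        refine Finset.sum_congr rfl fun b _ => ?_
        rw [Finset.sum_mul, Finset.sum_mul]
        exact Finset.sum_congr rfl fun c _ => by ring
    _ ≤ ∑ a ∈ t, B a a a * classMass D p π a := h

end DecisionTree

end

end Literature.Probability.Percolation
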